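import Summits.BirchSwinnertonDyer.BirchSwinnertonDyer.Theorems.Rank2ObservatoryRootNumberCert3
import Summits.BirchSwinnertonDyer.BirchSwinnertonDyer.Theorems.Rank2ObservatoryRank3RootNumber
import Summits.BirchSwinnertonDyer.BirchSwinnertonDyer.Theorems.Rank2ObservatoryRank3MinimalTotal
import HarnessLib

/-!
# BSD rank ≥ 2 observatory (`b2b-bsdr2`): root-number certificates WITH THE PLACE `3` for the
# rank-3 census — schema

HONEST FRAMING: per-curve certified theorems and census instruments; no claim on BSD in rank ≥ 2.

Glue between the census rows (`Rank3Row`, `Rank2ObservatoryRank3Table`) and the certificates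
`RNCert3` of `Rank2ObservatoryRootNumberCert3` (the `ℚ₂` table at `2`, Rizzo's Table II at `3`,
split / non-split / Rohrlich at the primes `≥ 5`, all evaluated in the kernel): the row predicate
`Rank3Row.RootNumberCertified3`, `w(E) = −1` for such a row GIVEN the tree's named fact
`WeierstrassCurve.rootNumber_eq_neg_finprod_fullTableLocalRootNumberAt` (`RootNumberTableThree`;
hypothesis `hR`), the one-pass position-indexed data check `posCheck3` decided by the kernel in the
data chunks `Rank2ObservatoryRank3RN3CertsN`, and the census headline theorems with `hw` replaced by
`hR` (and `hmin` dropped: `Rank3Row.isGloballyMinimal_of_mem`, `Rank2ObservatoryRank3MinimalTotal`).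

References: Rizzo 2003 [Rizzo2003]; Kellock–Dokchitser 2023 [KellockDokchitser2023]; Rohrlich 1993
[Rohrlich1993Compositio]; Cremona 1997, Tables [CremonaAlgorithms1997].
-/

set_option linter.dupNamespace false
set_option autoImplicit false

open WeierstrassCurve Literature Literature.NumberTheory.EllipticCurves

namespace Summit.BirchSwinnertonDyer.BirchSwinnertonDyer.Rank2Observatory

open RootNumber

/-- A row is ROOT-NUMBER CERTIFIED WITH THE PLACE `3` if some `RNCert3` checks on its integer model
with certified product `+1` (i.e. `w = −1` by the named fact). [folklore] -/
def Rank3Row.RootNumberCertified3 (r : Rank3Row) : Prop :=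
  ∃ c : RNCert3, c.check r.intModel = true ∧ c.sign r.intModel = 1

/-- **`w(E) = −1` for a row certified with the place `3`, modulo the named fact**
`rootNumber_eq_neg_finprod_fullTableLocalRootNumberAt` (Rizzo 2003 §1 + Table II at `3`, the
corrected Kellock–Dokchitser table at `2`, Rohrlich elsewhere; hypothesis `hR`).
[cite: Rizzo2003, §1 Fact 3 and Table II (p. 4)] -/
theorem Rank3Row.rootNumber_eq_neg_one_of_certified3 {r : Rank3Row} (h : r.RootNumberCertified3)
    (hR : r.curve.rootNumber_eq_neg_finprod_fullTableLocalRootNumberAt) : r.curve.rootNumber = -1 := by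
  obtain ⟨c, hc, hs⟩ := h
  rw [Rank3Row.curve_eq_baseChange] at hR ⊢
  rw [rootNumber_eq_neg_sign3 hc hR, hs]

/-- Position-indexed data check, ONE pass over the table: `ps` lists `(row index, certificate)` with
increasing indices; `n` is the index of the current head row; each listed certificate must check on
its row with certified product `+1`. [folklore] -/
def posCheck3 : List Rank3Row → ℕ → List (ℕ × RNCert3) → Bool
  | _, _, [] => true
  | [], _, _ :: _ => false
  | r :: rs, n, (i, c) :: rest =>
      if i = n then (c.check r.intModel && (c.sign r.intModel == 1)) && posCheck3 rs (n + 1) rest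
      else posCheck3 rs (n + 1) ((i, c) :: rest)

/-- What a passing position-indexed check says about each listed pair. [folklore] -/
theorem check_of_posCheck3 :
    ∀ (rows : List Rank3Row) (n : ℕ) (ps : List (ℕ × RNCert3)), posCheck3 rows n ps = true →
      ∀ (i : ℕ) (c : RNCert3), (i, c) ∈ ps →
        n ≤ i ∧ ∃ r : Rank3Row, rows[i - n]? = some r ∧ c.check r.intModel = true ∧
          c.sign r.intModel = 1
  | _, _, [], _, i, c, hm => by simp at hm
  | [], _, _ :: _, h, _, _, _ => by simp [posCheck3] at h
  | r :: rs, n, (j, d) :: rest, h, i, c, hm => by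
    by_cases hj : j = n
    · subst hj
      simp only [posCheck3, ↓reduceIte, Bool.and_eq_true, beq_iff_eq] at h
      rcases List.mem_cons.mp hm with he | hm'
      · obtain ⟨rfl, rfl⟩ := Prod.mk.inj he
        exact ⟨le_rfl, r, by simp, h.1.1, h.1.2⟩
      · obtain ⟨hle, r', hr', hc, hs⟩ := check_of_posCheck3 rs (j + 1) rest h.2 i c hm'
        refine ⟨by omega, r', ?_, hc, hs⟩
        rw [show i - j = (i - (j + 1)) + 1 by omega, List.getElem?_cons_succ]
        exact hr'
    · simp only [posCheck3, hj, ↓reduceIte] at h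
      obtain ⟨hle, r', hr', hc, hs⟩ := check_of_posCheck3 rs (n + 1) ((j, d) :: rest) h i c hm
      refine ⟨by omega, r', ?_, hc, hs⟩
      rw [show i - n = (i - (n + 1)) + 1 by omega, List.getElem?_cons_succ]
      exact hr'

/-- Table form (`n = 0`): a listed pair certifies its row. [folklore] -/
theorem Rank3Row.certified3_of_posCheck3 {rows : List Rank3Row} {ps : List (ℕ × RNCert3)}
    (h : posCheck3 rows 0 ps = true) {i : ℕ} {c : RNCert3} (hm : (i, c) ∈ ps) :
    ∃ hi : i < rows.length, (rows[i]'hi).RootNumberCertified3 := by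
  obtain ⟨-, r, hr, hc, hs⟩ := check_of_posCheck3 rows 0 ps h i c hm
  rw [Nat.sub_zero] at hr
  obtain ⟨hi, rfl⟩ := List.getElem?_eq_some_iff.mp hr
  exact ⟨hi, c, hc, hs⟩

/-- **`r_an(E) = rank_ℤ E(ℚ) (= 3)` for a row certified with the place `3`**: the census headline
`Rank3Row.analyticRank_eq_rank_kernel` with `hw` REPLACED by the named fact `hR`.
[cite: Rizzo2003, §1 Fact 3 and Table II (p. 4)] [cite: Darmon2004, Thm. 3.22] -/
theorem Rank3Row.analyticRank_eq_rank_kernel_rn3 {r : Rank3Row} (hr : r ∈ rank3Table)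
    (hrc : r.RootNumberCertified3) (hGZK : rank_eq_analyticRank_of_analyticRank_le_one)
    (hup : r.curve.mordellWeilRank ≤ 3) (hL3 : iteratedDeriv 3 r.curve.entireLFunction 1 ≠ 0)
    (hR : r.curve.rootNumber_eq_neg_finprod_fullTableLocalRootNumberAt) :
    r.curve.analyticRank = r.curve.mordellWeilRank :=
  Rank3Row.analyticRank_eq_rank_kernel hr hGZK hup hL3 (Rank3Row.rootNumber_eq_neg_one_of_certified3 hrc hR)

/-- **`L′(E,1) = 0` over `K = ℚ(√D)` for a row certified with the place `3`**: the census headline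
`Rank3Row.rank3_lderiv_eq_zero_kernel` with `hw` REPLACED by the named fact `hR` and `hmin`
DISCHARGED (`Rank3Row.isGloballyMinimal_of_mem`). [cite: Rizzo2003, §1 Fact 3 and Table II (p. 4)]
[cite: GrossLMS1991, (1.1) and Thm. 1.3] -/
theorem Rank3Row.rank3_lderiv_eq_zero_kernel_rn3 {r : Rank3Row} (hr : r ∈ rank3Table)
    (hrc : r.RootNumberCertified3) (K : Type) [Field K] [NumberField K]
    (hE : WeierstrassCurve.hasEntireLFunction_rat)
    (hGZKK : mordellWeilRank_eq_one_of_LDerivEK_ne_zero r.curve K)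
    (hN : r.curve.conductorNorm ℤ = r.N) (hK : IsImaginaryQuadratic K) (hdK : NumberField.discr K = r.D)
    (hR : r.curve.rootNumber_eq_neg_finprod_fullTableLocalRootNumberAt)
    (hLD : (r.curve.quadraticTwist (r.D : ℚ)).entireLFunction 1 ≠ 0) :
    deriv r.curve.entireLFunction 1 = 0 :=
  Rank3Row.rank3_lderiv_eq_zero_kernel hr K hE hGZKK (Rank3Row.isGloballyMinimal_of_mem hr) hN hK hdK
    (Rank3Row.rootNumber_eq_neg_one_of_certified3 hrc hR) hLD

/-- Kernel self-test: row `30` of the census (`27747c1 = [0,0,1,−327,2286]`, additive at `3`, Table II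
row `(2,3,≥6)`: `W₃ = −1`) is certified with the place `3` by `⟨0, 4, 3, 8, 2, 3, [(3083: split, root 1569)]⟩`.
[cite: CremonaAlgorithms1997, Tables] -/
theorem rootNumberCertified3_row30 :
    ∃ hi : 30 < rank3Table.length, (rank3Table[30]'hi).RootNumberCertified3 :=
  Rank3Row.certified3_of_posCheck3 (ps := [(30, ⟨0, 4, 3, 8, 2, 3, [⟨3083, 55, 1, 1, 1569⟩]⟩)])
    (by decide +kernel) (List.mem_singleton.mpr rfl)

end Summit.BirchSwinnertonDyer.BirchSwinnertonDyer.Rank2Observatory
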